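import Summits.BirchSwinnertonDyer.Rank1Residual.O5.HeegnerLogTransportThreeResidualEngine
import HarnessLib
import HarnessLib.Audit.Tags

/-!
# Heegner-log transport at `p = 3` (KL3), part 7 (continued): transport of the local conditions (§4), `#Sel_𝔭(K, X[p^∞]) = 1 ↔ #Sel_𝔭(K, Y[p^∞]) = 1` (§5),
# and KL3-M at a degree-one `𝔭` — `ResidualSelmerMatchingThreeDegOne` PROVED (§6) — o5-r2 GEN 20

HONEST FRAMING (cell `b2b-bsdres`, run/shared/lean/b2b/bsd-rank1-residual/, verbatim in every file): the
goal of the cell is to DELETE the COMBINATION-SHAPED residual classes of the Birch–Swinnerton-Dyer formula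
for ALL analytic-rank `≤ 1` elliptic curves over `ℚ` — "full BSD formula for every rank `≤ 1` curve in
class `C`" assembled STRICTLY from published theorems — so that the rank-`≤ 1` remainder becomes exactly
the CONSTRUCTION-SHAPED classes, which are TYPED (missing-input `Prop`s), NOT attempted. This is not
"finishing BSD". Team O5 (tame potentially supersingular additive `p = 3`, (t′)), planner o5-r2 (the
non-Iwasawa side), GEN 20; RESEARCH ROUTE; THEOREMS over explicit hypotheses: no new node is WANTED, no
Literature fact, no `@[conjecture]`, no new object (one `def … : Prop` naming the proved statement KL3-M°,
proved in this file; one `abbrev` for `θ_* = h1Equiv θ`); NOTHING is booked and no mark of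
`RESIDUAL-MAP.md` moves. O5 OPEN.

This is §4–§6 of o5-r2 GEN 20's file (i); §1–§3 (generic H¹ lemmas, the Kummer comparison `ι_*`, infinite places) and the MODULE TEXT describing the
whole (method, references [GreenbergLNM1716] / [Castella2018] / [Castella2018Erratum] / [DarmonDiamondTaylor1995] / [SilvermanAEC2009] / [KrizLi2019]) are the sibling
`O5/HeegnerLogTransportThreeResidualEngine.lean`, imported here; split only for `lint.size`.

## TYPER PLACEMENT NOTE (cc-typer-5 GEN 18; by-name ask A-O5-G20-1 of o5-r2 GEN 20, HOME/INBOX.md l.13845): THIS file = §4–§6 of source (i)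
`HOME/b2b-bsdres-o5-r2/gen20/lean/HeegnerLogTransportThreeResidual.lean` sha16 `85675e73a855d4e1` (634 l.; o5-r2 GEN 20's file (i), standalone `lean check` rc 0 / 0 warnings ×4 per l.13845)
— preamble + declaration blocks BYTE-IDENTICAL and in source order; it keeps the source's MODULE NAME so that `O5/HeegnerLogTransportThreeResidualEnd.lean` (file (ii))
imports it verbatim; the full placement note (cut rationale at the §3/§4 section boundary, farm checks rc 0 / 0 warnings, axioms std, DEDUP 24/24, content labels:
THEOREMS + one PROVED `def ResidualSelmerMatchingThreeDegOne : Prop` + one `abbrev torsionH1Map`, 0 `@[conjecture]`, 0 facts, no `sorry`) is in the Engine sibling's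
module text.  HONEST FRAMING as above: research route, lane CLASS-CLOSURE §3.5 O5; nothing booked; no mark of `RESIDUAL-MAP.md` moves; census = EVIDENCE; O5 OPEN.
-/

set_option autoImplicit false

open scoped Classical

open NumberField IsDedekindDomain Field IsDedekindDomain.HeightOneSpectrum
open WeierstrassCurve
open Literature.NumberTheory.EllipticCurves Literature.NumberTheory.EllipticCurves.GreenbergSelmer
open Literature.NumberTheory.GaloisRepresentations

noncomputable section

namespace Summit.BirchSwinnertonDyer.Rank1Residual.O5.HeegnerLogTransport

open Summit.BirchSwinnertonDyer.Rank1Residual.X11b Summit.BirchSwinnertonDyer.Rank1Residual.X11b.AcSelmer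
open Summit.BirchSwinnertonDyer.Rank1Residual.X11b.CongruentTransfer (baseChangeTorsionEquiv
  baseChangeTorsionEquiv_smul)

/-! ## §4 Transport of the local conditions along `θ : X[p] ≃ Y[p]` -/

section Transport

variable {K : Type} [Field K] [NumberField K] (X Y : WeierstrassCurve K) (p : ℕ)

section Theta

variable (θ : geomTorsion X (p : ℤ) ≃+ geomTorsion Y (p : ℤ))
  (hθ : ∀ (σ : absoluteGaloisGroup K) (P : geomTorsion X (p : ℤ)), θ (σ • P) = σ • θ P)

/-- `θ_* : H¹(H, X[p]) ≃+ H¹(H, Y[p])` at a level `H ≤ Γ_K` (`h1Equiv` for the restricted action).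
Serre, *Galois Cohomology*, I.§2.4. [folklore] -/
abbrev torsionH1Map (H : Subgroup (absoluteGaloisGroup K)) :
    subgroupH1 H (geomTorsion X (p : ℤ)) ≃+ subgroupH1 H (geomTorsion Y (p : ℤ)) :=
  h1Equiv θ (fun (g : H) m ↦ hθ g m)

/-- **Transport at a place where `X[p^∞]^{D_v}` has no `p`-torsion** (the place `𝔭` itself, and the
bad places `v ∤ p`, under `X(K_v)[p] = 0`): if `ι_* y` is locally trivial at `v` then so is
`ι_* θ_* y`. (`res_{D_v} ι_* y = ι_* res_{D_v} y = 0` and `ι_*` is injective on `H¹(D_v, ·)`, so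
`res_{D_v} y = 0`, so `res_{D_v} θ_* y = θ_* res_{D_v} y = 0`.) [cite: GreenbergLNM1716, §5 p. 114]
[cite: Castella2018Erratum, Thm. 1.1 (iv) (p. 1)] -/
theorem transport_mem_awayKer_of_fixed (v : HeightOneSpectrum (𝓞 K))
    (hX : ∀ m : X.geomPrimaryTorsion p, (∀ d ∈ decomp v, d • m = m) → p • m = 0 → m = 0)
    (y : subgroupH1 (⊤ : Subgroup (absoluteGaloisGroup K)) (geomTorsion X (p : ℤ)))
    (hy : X.torsionToPrimaryH1Sub p ⊤ y ∈ awayKer ⊤ (X.geomPrimaryTorsion p) v) :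
    Y.torsionToPrimaryH1Sub p ⊤ (torsionH1Map X Y p θ hθ ⊤ y) ∈
      awayKer ⊤ (Y.geomPrimaryTorsion p) v := by
  rw [awayKer, AddMonoidHom.mem_ker] at hy ⊢
  rw [resOfLe_torsionToPrimaryH1Sub] at hy
  have hinj := torsionToPrimaryH1Sub_injective_of_fixed X p (⊤ ⊓ decomp v) fun m hm hpm ↦
    hX m (fun d hd ↦ hm d (Subgroup.mem_inf.mpr ⟨Subgroup.mem_top d, hd⟩)) hpm
  have hy0 : resOfLe (geomTorsion X (p : ℤ)) (inf_le_left : ⊤ ⊓ decomp v ≤ ⊤) y = 0 :=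
    hinj (by rw [hy, map_zero])
  rw [resOfLe_torsionToPrimaryH1Sub,
    (resOfLe_h1Equiv_eq_zero_iff (inf_le_left : ⊤ ⊓ decomp v ≤ ⊤) θ hθ y).mpr hy0, map_zero]

/-- **Transport at a good place `v ∤ p` (good for both curves)**: if `ι_* y` is locally trivial at
`v` then so is `ι_* θ_* y`. Restrict to the inertia group `I_v` of the chosen prime above `v`, which
acts trivially on both `X[p^∞]` and `Y[p^∞]` (Silverman VII.4.1(a)): `res_{I_v} ι_* y = 0 ⟹
res_{I_v} y = 0` (`ι_*` injective on `H¹(I_v, ·)`) `⟹ res_{I_v} θ_* y = 0 ⟹ res_{I_v} ι_* θ_* y = 0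
⟹ res_{D_v} ι_* θ_* y = 0` by Greenberg's Lemma 3.3 (`H¹(D_v, Y[p^∞]) ↪ H¹(I_v, Y[p^∞])`).
[cite: GreenbergLNM1716, §3 Lemma 3.3 (p. 87)] [cite: SilvermanAEC2009, Prop. VII.4.1(a)] -/
theorem transport_mem_awayKer_of_good [X.IsElliptic] [Y.IsElliptic] [Fact p.Prime]
    {v : HeightOneSpectrum (𝓞 K)} (hpv : (p : 𝓞 K) ∉ v.asIdeal)
    (hvX : X.HasGoodReductionAt v) (hvY : Y.HasGoodReductionAt v)
    (y : subgroupH1 (⊤ : Subgroup (absoluteGaloisGroup K)) (geomTorsion X (p : ℤ)))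
    (hy : X.torsionToPrimaryH1Sub p ⊤ y ∈ awayKer ⊤ (X.geomPrimaryTorsion p) v) :
    Y.torsionToPrimaryH1Sub p ⊤ (torsionH1Map X Y p θ hθ ⊤ y) ∈
      awayKer ⊤ (Y.geomPrimaryTorsion p) v := by
  rw [awayKer, AddMonoidHom.mem_ker] at hy ⊢
  have hI : (adicCompletionPrime K v).inertia (absoluteGaloisGroup K) ≤ ⊤ ⊓ decomp v :=
    le_inf le_top (inertia_adicCompletionPrime_le_decomp v)
  have h𝔓₀ := adicCompletionPrime_mem_primesAbove K v
  -- X side: `res_{I_v} y = 0`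
  have h1 : resOfLe (X.geomPrimaryTorsion p) (hI.trans (inf_le_left : ⊤ ⊓ decomp v ≤ ⊤))
      (X.torsionToPrimaryH1Sub p ⊤ y) = 0 := by
    rw [← Literature.NumberTheory.EllipticCurves.resOfLe_comp_holds hI
      (inf_le_left : ⊤ ⊓ decomp v ≤ ⊤), AddMonoidHom.comp_apply, hy, map_zero]
  rw [resOfLe_torsionToPrimaryH1Sub] at h1
  have hinjX := torsionToPrimaryH1Sub_injective_of_trivial X p
    ((adicCompletionPrime K v).inertia (absoluteGaloisGroup K))
    fun σ hσ m ↦ smul_geomPrimaryTorsion_eq_of_mem_inertia X p hpv hvX h𝔓₀ hσ m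
  have hy0 : resOfLe (geomTorsion X (p : ℤ)) (hI.trans (inf_le_left : ⊤ ⊓ decomp v ≤ ⊤)) y = 0 :=
    hinjX (by rw [h1, map_zero])
  -- Y side: `res_{I_v} ι_* θ_* y = 0`, then Lemma 3.3
  have h2 : resOfLe (Y.geomPrimaryTorsion p) (hI.trans (inf_le_left : ⊤ ⊓ decomp v ≤ ⊤))
      (Y.torsionToPrimaryH1Sub p ⊤ (torsionH1Map X Y p θ hθ ⊤ y)) = 0 := by
    rw [resOfLe_torsionToPrimaryH1Sub,
      (resOfLe_h1Equiv_eq_zero_iff (hI.trans (inf_le_left : ⊤ ⊓ decomp v ≤ ⊤)) θ hθ y).mpr hy0,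
      map_zero]
  apply resOfLe_inertia_top_inf_injective_of_hasGoodReductionAt Y p hpv hvY hI
  rw [map_zero, ← AddMonoidHom.comp_apply,
    Literature.NumberTheory.EllipticCurves.resOfLe_comp_holds hI (inf_le_left : ⊤ ⊓ decomp v ≤ ⊤)]
  exact h2

end Theta

/-- **The Selmer transport, one direction.** Hypotheses: `θ : X[p] ≃ Y[p]` `Γ_K`-equivariant;
`K` totally complex; at `𝔭`: `X[p^∞]^{D_𝔭}[p] = 0` and `Y[p^∞]^{D_𝔭}[p] = 0`; at every finite
`v ∤ p`: either both curves have good reduction, or both `X[p^∞]^{D_v}[p] = 0` and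
`Y[p^∞]^{D_v}[p] = 0`. Then `Sel_𝔭(K, Y[p^∞]) = 0 ⟹ Sel_𝔭(K, X[p^∞])[p] = 0`: a class `c` with
`p c = 0` lifts to `y ∈ H¹(K, X[p])` (Kummer), `ι_* θ_* y` satisfies every local condition of
`Sel_𝔭(K, Y[p^∞])` (§4), hence vanishes, hence `θ_* y = 0` (`ι_*` injective: `Y(K)[p] ⊆
Y[p^∞]^{D_𝔭}[p] = 0`), `y = 0`, `c = 0`. [cite: GreenbergLNM1716, §5 p. 114] [cite: Castella2018, Def. 2.2 (arXiv:1704.06608 p. 5)] -/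
theorem selmerAcBase_nsmul_eq_zero_of_transport [X.IsElliptic] [Y.IsElliptic] [Fact p.Prime]
    [IsTotallyComplex K] (θ : geomTorsion X (p : ℤ) ≃+ geomTorsion Y (p : ℤ))
    (hθ : ∀ (σ : absoluteGaloisGroup K) (P : geomTorsion X (p : ℤ)), θ (σ • P) = σ • θ P)
    (𝔭 : HeightOneSpectrum (𝓞 K))
    (h𝔭X : ∀ m : X.geomPrimaryTorsion p, (∀ d ∈ decomp 𝔭, d • m = m) → p • m = 0 → m = 0)
    (h𝔭Y : ∀ m : Y.geomPrimaryTorsion p, (∀ d ∈ decomp 𝔭, d • m = m) → p • m = 0 → m = 0)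
    (hv : ∀ v : HeightOneSpectrum (𝓞 K), (p : 𝓞 K) ∉ v.asIdeal →
      (X.HasGoodReductionAt v ∧ Y.HasGoodReductionAt v) ∨
      ((∀ m : X.geomPrimaryTorsion p, (∀ d ∈ decomp v, d • m = m) → p • m = 0 → m = 0) ∧
        (∀ m : Y.geomPrimaryTorsion p, (∀ d ∈ decomp v, d • m = m) → p • m = 0 → m = 0)))
    (hY : ∀ c ∈ selmerAcBase Y p 𝔭 ∅, c = 0)
    (c : X.subgroupH1 p ⊤) (hc : c ∈ selmerAcBase X p 𝔭 ∅) (hpc : p • c = 0) : c = 0 := by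
  -- Kummer lift
  obtain ⟨y, rfl⟩ := X.exists_torsionToPrimaryH1Sub_eq p (X.zsmul_geomPoints_surjective_holds) hpc
  have hcX := (mem_selmerOver_top_iff (M := X.geomPrimaryTorsion p) _).mp hc
  -- the transported class lies in `Sel_𝔭(K, Y[p^∞])`
  have hc' : Y.torsionToPrimaryH1Sub p ⊤ (torsionH1Map X Y p θ hθ ⊤ y) ∈ selmerAcBase Y p 𝔭 ∅ := by
    refine (mem_selmerOver_top_iff (M := Y.geomPrimaryTorsion p) _).mpr ⟨fun v hpv _ ↦ ?_,
      fun w ↦ mem_infKer_top_of_isTotallyComplex w _, ?_⟩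
    · have hyv := hcX.1 v hpv (Set.notMem_empty v)
      rcases hv v hpv with ⟨hvX, hvY⟩ | ⟨hXv, -⟩
      · exact transport_mem_awayKer_of_good X Y p θ hθ hpv hvX hvY y hyv
      · exact transport_mem_awayKer_of_fixed X Y p θ hθ v hXv y hyv
    · rw [mem_strictKer_strictDatum_iff_mem_awayKer]
      have hy𝔭 := hcX.2.2
      rw [mem_strictKer_strictDatum_iff_mem_awayKer] at hy𝔭
      exact transport_mem_awayKer_of_fixed X Y p θ hθ 𝔭 h𝔭X y hy𝔭
  have h0 := hY _ hc'
  -- `ι_*` is injective on `H¹(K, ·)` for `Y`: `Y[p^∞]^{Γ_K}[p] ⊆ Y[p^∞]^{D_𝔭}[p] = 0`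
  have hinjY := torsionToPrimaryH1Sub_injective_of_fixed Y p ⊤ fun m hm hpm ↦
    h𝔭Y m (fun d _ ↦ hm d (Subgroup.mem_top d)) hpm
  have hy0 : torsionH1Map X Y p θ hθ ⊤ y = 0 := hinjY (by rw [h0, map_zero])
  rw [map_eq_zero_iff _ (torsionH1Map X Y p θ hθ ⊤).injective] at hy0
  rw [hy0, map_zero]

end Transport

/-! ## §5 The symmetric statement: `#Sel_𝔭(K, X[p^∞]) = 1 ↔ #Sel_𝔭(K, Y[p^∞]) = 1` -/

section Selmer

variable {K : Type} [Field K] [NumberField K] (X Y : WeierstrassCurve K) (p : ℕ)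

/-- Every class of `Sel_𝔭(K, E[p^∞]) ⊆ H¹(K, E[p^∞])` is `p`-power torsion (`Γ_K` compact,
`E[p^∞]` `p`-primary: `exists_pow_nsmul_eq_zero_subgroupH1`). [cite: GreenbergLNM1716, §2] -/
theorem exists_pow_nsmul_eq_zero_selmerAcBase (𝔭 : HeightOneSpectrum (𝓞 K))
    (c : selmerAcBase X p 𝔭 ∅) : ∃ k : ℕ, p ^ k • c = 0 := by
  haveI : CompactSpace (absoluteGaloisGroup K) := compactSpace_absoluteGaloisGroup K
  have hM : ∀ m : X.geomPrimaryTorsion p, ∃ k : ℕ, p ^ k • m = 0 := fun m ↦ by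
    obtain ⟨k, hk⟩ := AddCommGroup.mem_primaryComponent.mp m.2
    exact ⟨k, Subtype.ext (by rw [AddSubmonoidClass.coe_nsmul, hk, ZeroMemClass.coe_zero])⟩
  obtain ⟨k, hk⟩ := exists_pow_nsmul_eq_zero_subgroupH1 (⊤ : Subgroup (absoluteGaloisGroup K))
    (by rw [Subgroup.coe_top]; exact isClosed_univ) hM (c : X.subgroupH1 p ⊤)
  exact ⟨k, Subtype.ext (by rw [AddSubmonoidClass.coe_nsmul, hk, ZeroMemClass.coe_zero])⟩

/-- `#Sel_𝔭(K, E[p^∞]) = 1 ↔ Sel_𝔭(K, E[p^∞])[p] = 0`. [folklore] -/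
theorem natCard_selmerAcBase_eq_one_iff (𝔭 : HeightOneSpectrum (𝓞 K)) :
    Nat.card (selmerAcBase X p 𝔭 ∅) = 1 ↔
      ∀ c ∈ selmerAcBase X p 𝔭 ∅, p • c = 0 → c = 0 := by
  rw [natCard_eq_one_iff_forall_nsmul (exists_pow_nsmul_eq_zero_selmerAcBase X p 𝔭)]
  constructor
  · intro h c hc hpc
    have := h ⟨c, hc⟩ (Subtype.ext (by
      rw [AddSubmonoidClass.coe_nsmul, ZeroMemClass.coe_zero]; exact hpc))
    exact congrArg Subtype.val this
  · intro h c hpc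
    exact Subtype.ext (h c.1 c.2 (by
      rw [← AddSubmonoidClass.coe_nsmul, hpc, ZeroMemClass.coe_zero]))

/-- **Residual transport of `#Sel_𝔭 = 1` (symmetric form).** For elliptic curves `X`, `Y` over a
totally complex number field `K` with `Γ_K`-isomorphic `p`-torsion `θ : X[p] ≃ Y[p]`, a finite place
`𝔭` with `X(K_𝔭)`- and `Y(K_𝔭)`-descent data `X[p^∞]^{D_𝔭}[p] = Y[p^∞]^{D_𝔭}[p] = 0`, and, at every
finite `v ∤ p`, either good reduction of both curves or `X[p^∞]^{D_v}[p] = Y[p^∞]^{D_v}[p] = 0`: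
`#Sel_𝔭(K, X[p^∞]) = 1 ↔ #Sel_𝔭(K, Y[p^∞]) = 1`. [cite: GreenbergLNM1716, §3 Lemma 3.3 (p. 87) and §5 p. 114]
[cite: Castella2018, Def. 2.2 (arXiv:1704.06608 p. 5)] -/
theorem natCard_selmerAcBase_eq_one_iff_of_torsionEquiv [X.IsElliptic] [Y.IsElliptic] [Fact p.Prime]
    [IsTotallyComplex K]
    (θ : geomTorsion X (p : ℤ) ≃+ geomTorsion Y (p : ℤ))
    (hθ : ∀ (σ : absoluteGaloisGroup K) (P : geomTorsion X (p : ℤ)), θ (σ • P) = σ • θ P)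
    (𝔭 : HeightOneSpectrum (𝓞 K))
    (h𝔭X : ∀ m : X.geomPrimaryTorsion p, (∀ d ∈ decomp 𝔭, d • m = m) → p • m = 0 → m = 0)
    (h𝔭Y : ∀ m : Y.geomPrimaryTorsion p, (∀ d ∈ decomp 𝔭, d • m = m) → p • m = 0 → m = 0)
    (hv : ∀ v : HeightOneSpectrum (𝓞 K), (p : 𝓞 K) ∉ v.asIdeal →
      (X.HasGoodReductionAt v ∧ Y.HasGoodReductionAt v) ∨
      ((∀ m : X.geomPrimaryTorsion p, (∀ d ∈ decomp v, d • m = m) → p • m = 0 → m = 0) ∧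
        (∀ m : Y.geomPrimaryTorsion p, (∀ d ∈ decomp v, d • m = m) → p • m = 0 → m = 0))) :
    Nat.card (selmerAcBase X p 𝔭 ∅) = 1 ↔ Nat.card (selmerAcBase Y p 𝔭 ∅) = 1 := by
  have hv' : ∀ v : HeightOneSpectrum (𝓞 K), (p : 𝓞 K) ∉ v.asIdeal →
      (Y.HasGoodReductionAt v ∧ X.HasGoodReductionAt v) ∨
      ((∀ m : Y.geomPrimaryTorsion p, (∀ d ∈ decomp v, d • m = m) → p • m = 0 → m = 0) ∧
        (∀ m : X.geomPrimaryTorsion p, (∀ d ∈ decomp v, d • m = m) → p • m = 0 → m = 0)) :=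
    fun v hpv ↦ (hv v hpv).imp And.symm And.symm
  constructor
  · intro hX
    rw [natCard_selmerAcBase_eq_one_iff]
    have hX0 : ∀ c ∈ selmerAcBase X p 𝔭 ∅, c = 0 := fun c hc ↦ by
      haveI := (Nat.card_eq_one_iff_unique.mp hX).1
      exact congrArg Subtype.val (Subsingleton.elim (⟨c, hc⟩ : selmerAcBase X p 𝔭 ∅) 0)
    exact selmerAcBase_nsmul_eq_zero_of_transport Y X p θ.symm (symm_equivariant θ hθ) 𝔭 h𝔭Y h𝔭X
      hv' hX0
  · intro hY
    rw [natCard_selmerAcBase_eq_one_iff]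
    have hY0 : ∀ c ∈ selmerAcBase Y p 𝔭 ∅, c = 0 := fun c hc ↦ by
      haveI := (Nat.card_eq_one_iff_unique.mp hY).1
      exact congrArg Subtype.val (Subsingleton.elim (⟨c, hc⟩ : selmerAcBase Y p 𝔭 ∅) 0)
    exact selmerAcBase_nsmul_eq_zero_of_transport X Y p θ hθ 𝔭 h𝔭X h𝔭Y hv hY0

end Selmer

/-! ## §6 KL3-M at a degree-one `𝔭`: `ResidualSelmerMatchingThreeDegOne` and its proof -/

section KL3M

/-- **KL3-M° `ResidualSelmerMatchingThreeDegOne`** — KL3-M (`ResidualSelmerMatchingThree`, part 1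
§KL3-M) with the two binders `e(𝔭|3) = f(𝔭|3) = 1` that every consumer already holds (the END's
`he`, `hf`; automatic when `3 ∣ N_W N_G`, in particular on all O5 rows, where `W` is additive at `3`):
for a mod-3 congruent pair `(W, G)` with `ρ̄_{W,3}` surjective, `W(ℚ₃)[3] = 0`, `W(ℚ_ℓ)[3] = 0` at the
bad `ℓ ≠ 3` of `W` or `G`, an imaginary quadratic `K` in which every `ℓ ∣ N_W N_G` splits, and a
DEGREE-ONE prime `𝔭 ∣ 3` of `K`: `#Sel_𝔭(K, W[3^∞]) = 1 ↔ #Sel_𝔭(K, G[3^∞]) = 1`. THEOREM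
(`residualSelmerMatchingThreeDegOne_holds`). The binder-free KL3-M additionally covers `3 ∤ N_W N_G`
with `3` inert or ramified in `K`, where `K_𝔭 ≠ ℚ₃` and `W(ℚ₃)[3] = 0` does not control
`W(K_𝔭)[3^∞]/3` — outside the reach of residual matching (and off the O5 population).
[cite: GreenbergLNM1716, §3 Lemma 3.3 (p. 87) and §5 p. 114] [cite: Castella2018, Def. 2.2 (arXiv:1704.06608 p. 5)]
[cite: DarmonDiamondTaylor1995, Prop. 2.6 (b) (PDF p. 53)] -/
def ResidualSelmerMatchingThreeDegOne : Prop :=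
  ∀ (W G : WeierstrassCurve ℚ) [W.IsElliptic] [W.IsGloballyMinimal] [G.IsElliptic] [G.IsGloballyMinimal],
    W.HasSurjectiveModNGaloisRep 3 →
    (∀ ℓ : ℕ, ℓ.Prime → ¬ (ℓ ∣ 3 * W.conductorNorm ℤ * G.conductorNorm ℤ) →
      ((W.LFunction ℓ : ℤ) : ZMod 3) = ((G.LFunction ℓ : ℤ) : ZMod 3)) →
    NoLocalThreeTorsionAt W 3 →
    (∀ (ℓ : ℕ) [Fact ℓ.Prime], ℓ ≠ 3 → (ℓ : ℤ) ∣ W.conductorNorm ℤ * G.conductorNorm ℤ →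
      NoLocalThreeTorsionAt W ℓ) →
    ∀ (K : Type) [Field K] [NumberField K], IsImaginaryQuadratic K →
      SatisfiesHeegnerHypothesis (W.conductorNorm ℤ * G.conductorNorm ℤ) K →
      ∀ (𝔭 : HeightOneSpectrum (𝓞 K)), ((3 : ℕ) : 𝓞 K) ∈ 𝔭.asIdeal →
        𝔭.asIdeal.ramificationIdx (𝓞 ℚ) = 1 → 𝔭.asIdeal.inertiaDeg (𝓞 ℚ) = 1 →
        (Nat.card (selmerAcBase (W.baseChange K) 3 𝔭 ∅) = 1 ↔
          Nat.card (selmerAcBase (G.baseChange K) 3 𝔭 ∅) = 1)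

/-- **Local descent data on a congruent pair.** At a place `v` of `K` with a ring map `K_v → ℚ_ℓ`
and `W(ℚ_ℓ)[3] = 0`: `W_K[3^∞]^{D_v}[3] = 0` and `G_K[3^∞]^{D_v}[3] = 0` (`G(ℚ_ℓ)[3] = 0` along the
congruence, `noLocalThreeTorsionAt_of_isCongruentModThree`; points over `K_v ↪ ℚ_ℓ`; Galois descent
`eq_zero_of_fixed_decomp_of_local`). [cite: SilvermanAEC2009, VIII.§1 (proof of Prop. 1.2)]
[cite: DarmonDiamondTaylor1995, Prop. 2.6 (b) (PDF p. 53)] -/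
theorem fixed_decomp_noThreeTorsion_pair (W G : WeierstrassCurve ℚ) [W.IsElliptic] [W.IsGloballyMinimal]
    [G.IsElliptic] [G.IsGloballyMinimal] (hirr : W.HasIrreducibleModPGaloisRep 3)
    (hcong : IsCongruentModThree W G) {K : Type} [Field K] [NumberField K]
    (v : HeightOneSpectrum (𝓞 K)) (ℓ : ℕ) [Fact ℓ.Prime] (e : v.adicCompletion K →+* ℚ_[ℓ])
    (hW : NoLocalThreeTorsionAt W ℓ) :
    (∀ m : (W.baseChange K).geomPrimaryTorsion 3, (∀ d ∈ decomp v, d • m = m) → 3 • m = 0 → m = 0) ∧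
      ∀ m : (G.baseChange K).geomPrimaryTorsion 3, (∀ d ∈ decomp v, d • m = m) → 3 • m = 0 → m = 0 := by
  have hG : NoLocalThreeTorsionAt G ℓ := noLocalThreeTorsionAt_of_isCongruentModThree W G hirr hcong ℓ hW
  have hW' := (noLocalThreeTorsionAt_iff_forall_three_nsmul W ℓ).mp hW
  have hG' := (noLocalThreeTorsionAt_iff_forall_three_nsmul G ℓ).mp hG
  exact ⟨eq_zero_of_fixed_decomp_of_local (W.baseChange K) 3 v
      (noPTorsion_baseChange_adicCompletion_of_ringHom W 3 v e hW'),
    eq_zero_of_fixed_decomp_of_local (G.baseChange K) 3 v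
      (noPTorsion_baseChange_adicCompletion_of_ringHom G 3 v e hG')⟩

/-- **KL3-M° is a THEOREM.** Proof: `ρ̄_{W,3}` surjective ⟹ irreducible ⟹ a `Γ_ℚ`-equivariant
`θ : W[3] ≃ G[3]` (Brauer–Nesbitt–Chebotarev, `exists_addEquiv_geomTorsion_of_isCongruentModThree'`),
base-changed to a `Γ_K`-equivariant `θ_K : W_K[3] ≃ G_K[3]` (`baseChangeTorsionEquiv`); the
symmetric Selmer transport `natCard_selmerAcBase_eq_one_iff_of_torsionEquiv` (§5) applies with: at `𝔭`
(degree one: `K_𝔭 ≃ ℚ₃`, `exists_ringHom_adicCompletion_padic_of_degreeOne`) the descent data from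
`W(ℚ₃)[3] = 0`; at a finite `v ∤ 3` either both `W_K`, `G_K` have good reduction, or the prime `ℓ`
below `v` divides `N_W N_G` (`primesEquiv_under_dvd_conductorNorm_of_not_hasGoodReductionAt`), hence
splits in `K` (Heegner hypothesis for `N_W N_G`), so `v` has degree one (`splitsIn_primesEquiv_under_iff`),
`K_v ≃ ℚ_ℓ`, and the descent data come from `W(ℚ_ℓ)[3] = 0` (`htℓ`). [cite: GreenbergLNM1716, §3 Lemma 3.3 (p. 87) and §5 p. 114]
[cite: Castella2018, Def. 2.2 (arXiv:1704.06608 p. 5)] [cite: DarmonDiamondTaylor1995, Prop. 2.6 (b) (PDF p. 53)]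
[cite: SilvermanAEC2009, Prop. VII.4.1(a) and VIII.§1] -/
theorem residualSelmerMatchingThreeDegOne_holds : ResidualSelmerMatchingThreeDegOne := by
  intro W G _ _ _ _ hρ hcong ht3 htℓ K _ _ hK hHWG 𝔭 h𝔭 he hf
  haveI : IsTotallyComplex K := hK.2
  haveI : (W.baseChange K).IsElliptic := by rw [WeierstrassCurve.baseChange]; infer_instance
  haveI : (G.baseChange K).IsElliptic := by rw [WeierstrassCurve.baseChange]; infer_instance
  have hirrW : W.HasIrreducibleModPGaloisRep 3 :=
    hasIrreducibleModPGaloisRep_of_hasSurjectiveModNGaloisRep W 3 hρ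
  obtain ⟨θ, hθ⟩ := exists_addEquiv_geomTorsion_of_isCongruentModThree' W G hirrW hcong
  have h3 : (3 : ℤ) ≠ 0 := by norm_num
  refine natCard_selmerAcBase_eq_one_iff_of_torsionEquiv (W.baseChange K) (G.baseChange K) 3
    (baseChangeTorsionEquiv W G K h3 θ) (baseChangeTorsionEquiv_smul W G K h3 θ hθ) 𝔭 ?_ ?_ ?_
  · obtain ⟨e⟩ := exists_ringHom_adicCompletion_padic_of_degreeOne 3 𝔭 h𝔭 he hf
    exact (fixed_decomp_noThreeTorsion_pair W G hirrW hcong 𝔭 3 e ht3).1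
  · obtain ⟨e⟩ := exists_ringHom_adicCompletion_padic_of_degreeOne 3 𝔭 h𝔭 he hf
    exact (fixed_decomp_noThreeTorsion_pair W G hirrW hcong 𝔭 3 e ht3).2
  · intro v h3v
    by_cases hgood : (W.baseChange K).HasGoodReductionAt v ∧ (G.baseChange K).HasGoodReductionAt v
    · exact Or.inl hgood
    · right
      -- the prime `ℓ` below `v` divides `N_W N_G`, hence splits in `K`, so `v` has degree one
      haveI hℓp : Fact (Rat.HeightOneSpectrum.primesEquiv (v.under (𝓞 ℚ)) : ℕ).Prime :=
        ⟨(Rat.HeightOneSpectrum.primesEquiv (v.under (𝓞 ℚ))).2⟩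
      have hℓv := natCast_primesEquiv_under_mem v
      have hdvd : (Rat.HeightOneSpectrum.primesEquiv (v.under (𝓞 ℚ)) : ℕ) ∣
          W.conductorNorm ℤ * G.conductorNorm ℤ := by
        rcases not_and_or.mp hgood with hW | hG
        · exact dvd_mul_of_dvd_left
            (primesEquiv_under_dvd_conductorNorm_of_not_hasGoodReductionAt K v hW) _
        · exact dvd_mul_of_dvd_right
            (primesEquiv_under_dvd_conductorNorm_of_not_hasGoodReductionAt K v hG) _
      have hℓ3 : (Rat.HeightOneSpectrum.primesEquiv (v.under (𝓞 ℚ)) : ℕ) ≠ 3 := by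
        intro h3'
        exact h3v (h3' ▸ hℓv)
      have hsplit : SplitsIn K (Rat.HeightOneSpectrum.primesEquiv (v.under (𝓞 ℚ)) : ℕ) :=
        hHWG _ hℓp.out hdvd
      obtain ⟨he1, hf1⟩ := (splitsIn_primesEquiv_under_iff hK.1 v).mp hsplit
      have htW : NoLocalThreeTorsionAt W (Rat.HeightOneSpectrum.primesEquiv (v.under (𝓞 ℚ)) : ℕ) :=
        htℓ _ hℓ3 (by exact_mod_cast hdvd)
      obtain ⟨e⟩ := exists_ringHom_adicCompletion_padic_of_degreeOne
        (Rat.HeightOneSpectrum.primesEquiv (v.under (𝓞 ℚ)) : ℕ) v hℓv he1 hf1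
      exact fixed_decomp_noThreeTorsion_pair W G hirrW hcong v _ e htW

/-- **KL3-M° in applied form** (the shape consumed by the ENDs, `he`/`hf` in context). [folklore] -/
theorem natCard_selmerAcBase_eq_one_iff_companion (W G : WeierstrassCurve ℚ) [W.IsElliptic]
    [W.IsGloballyMinimal] [G.IsElliptic] [G.IsGloballyMinimal] (hρ : W.HasSurjectiveModNGaloisRep 3)
    (hcong : ∀ ℓ : ℕ, ℓ.Prime → ¬ (ℓ ∣ 3 * W.conductorNorm ℤ * G.conductorNorm ℤ) →
      ((W.LFunction ℓ : ℤ) : ZMod 3) = ((G.LFunction ℓ : ℤ) : ZMod 3))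
    (ht3 : NoLocalThreeTorsionAt W 3)
    (htℓ : ∀ (ℓ : ℕ) [Fact ℓ.Prime], ℓ ≠ 3 → (ℓ : ℤ) ∣ W.conductorNorm ℤ * G.conductorNorm ℤ →
      NoLocalThreeTorsionAt W ℓ)
    (K : Type) [Field K] [NumberField K] (hK : IsImaginaryQuadratic K)
    (hHWG : SatisfiesHeegnerHypothesis (W.conductorNorm ℤ * G.conductorNorm ℤ) K)
    (𝔭 : HeightOneSpectrum (𝓞 K)) (h𝔭 : ((3 : ℕ) : 𝓞 K) ∈ 𝔭.asIdeal)
    (he : 𝔭.asIdeal.ramificationIdx (𝓞 ℚ) = 1) (hf : 𝔭.asIdeal.inertiaDeg (𝓞 ℚ) = 1) :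
    Nat.card (selmerAcBase (W.baseChange K) 3 𝔭 ∅) = 1 ↔
      Nat.card (selmerAcBase (G.baseChange K) 3 𝔭 ∅) = 1 :=
  residualSelmerMatchingThreeDegOne_holds W G hρ hcong ht3 htℓ K hK hHWG 𝔭 h𝔭 he hf

/-- **KL3-M WITHOUT the degree-one binders when `3 ∣ N_W N_G`** (e.g. `W` additive at `3`, all O5 rows):
then `3` splits in `K` by the Heegner hypothesis and every `𝔭 ∣ 3` has degree one. [folklore] -/
theorem natCard_selmerAcBase_eq_one_iff_companion_of_three_dvd (W G : WeierstrassCurve ℚ) [W.IsElliptic]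
    [W.IsGloballyMinimal] [G.IsElliptic] [G.IsGloballyMinimal] (hρ : W.HasSurjectiveModNGaloisRep 3)
    (hcong : ∀ ℓ : ℕ, ℓ.Prime → ¬ (ℓ ∣ 3 * W.conductorNorm ℤ * G.conductorNorm ℤ) →
      ((W.LFunction ℓ : ℤ) : ZMod 3) = ((G.LFunction ℓ : ℤ) : ZMod 3))
    (ht3 : NoLocalThreeTorsionAt W 3)
    (htℓ : ∀ (ℓ : ℕ) [Fact ℓ.Prime], ℓ ≠ 3 → (ℓ : ℤ) ∣ W.conductorNorm ℤ * G.conductorNorm ℤ →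
      NoLocalThreeTorsionAt W ℓ)
    (h3N : 3 ∣ W.conductorNorm ℤ * G.conductorNorm ℤ)
    (K : Type) [Field K] [NumberField K] (hK : IsImaginaryQuadratic K)
    (hHWG : SatisfiesHeegnerHypothesis (W.conductorNorm ℤ * G.conductorNorm ℤ) K)
    (𝔭 : HeightOneSpectrum (𝓞 K)) (h𝔭 : ((3 : ℕ) : 𝓞 K) ∈ 𝔭.asIdeal) :
    Nat.card (selmerAcBase (W.baseChange K) 3 𝔭 ∅) = 1 ↔
      Nat.card (selmerAcBase (G.baseChange K) 3 𝔭 ∅) = 1 :=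
  have hsplit : SplitsIn K 3 := hHWG 3 Nat.prime_three h3N
  residualSelmerMatchingThreeDegOne_holds W G hρ hcong ht3 htℓ K hK hHWG 𝔭 h𝔭
    (degreeOne_of_splitsIn hK.1 hsplit h𝔭).1 (degreeOne_of_splitsIn hK.1 hsplit h𝔭).2

/-- **KL3-M° from KL3-M** (the binder-free node implies the degree-one node trivially; recorded so
that the END's four-binder form stays citable). [folklore] -/
theorem residualSelmerMatchingThreeDegOne_of (hM : ResidualSelmerMatchingThree) :
    ResidualSelmerMatchingThreeDegOne :=
  fun W G _ _ _ _ hρ hcong ht3 htℓ K _ _ hK hHWG 𝔭 h𝔭 _ _ ↦ hM W G hρ hcong ht3 htℓ K hK hHWG 𝔭 h𝔭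

end KL3M

end Summit.BirchSwinnertonDyer.Rank1Residual.O5.HeegnerLogTransport

end
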